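/-
Copyright: the b2b-balaban T⁴-continuum CRUX team, row NE7b OWNER lineage `t4-ne7b-p1` (gen 124). Project licence.
-/
import Summits.QuantumFields.BalabanUV.T4Continuum.Spine.NE7b.SupZdResponseTorusLimit
import Summits.QuantumFields.BalabanUV.T4Continuum.Spine.NE7b.SupZdPropagatorPeriodic

/-!
# THE THERMODYNAMIC LIMIT OF THE FLUCTUATION COVARIANCE: along the tower `3^k`, the torus road's fluctuation part of a block source —
# `u_k − Σ_{y′}(Σ_{y″}T_k⁻¹(y′,y″)m_k(y″))ψ^k_{y′}` ((139): `u_k = H_k⁻¹(f∘wm_k)`, `m_k` its block means, `T_k⁻¹` the inverse Schur complement,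
# `ψ^k` the torus block columns) — read at `σ_kp` CONVERGES, for every `p ∈ ℤ^d`, to the infinite-volume fluctuation part
# `u(p) − Σ′_{b″}m(b″)h_{b″}(p)` of (201); with (199) (Hessian) and (204) (response) ALL THREE next-scale objects of the linear column now
# have thermodynamic limits, every `V : ℤ^d → [−λ, Λ]`, `d ≥ 3`, every mesh (row NE7b, node U5c; (135)∕(152)∕(155)∕(184)∕(204) BY NAME +
# Tannery; [folklore])

Cell `pub-balaban`, sub-cell `t4`, spine estimate NE7b (`T4WeightBudget.RelWeightBound`; the cell's OWN estimate — NOT PRINTED in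
[Bałaban 1983–89], NOT PROVED).  Crux-route work under `Spine/NE7b/` by the row OWNER (`t4-ne7b-p1` gen 124, file (206)) under FREEZE
(0)'s crux-prover clause; NOTHING of Bałaban's is named as a Lean object, valued or asserted; no `T4Continuum/Support` leaf typed; no `def`,
no notation (both fluctuation parts WRITTEN OUT, the torus one in (139)'s display; all objects ANY data with their displayed properties);
zero `sorry`.  Imports (BY NAME): the OWNER's (204) `…SupZdResponseTorusLimit` (`torus_response_tendsto`; through it (199), (197)
`torusNorm_eq_l1`, (186) `sum_window_reading`, (184) `bounded_solution_is_tower_limit`, (180), (155) `propagator_pointwise_decay_road`, (152)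
`supNorm_bound_road`, (135) `nextScale_hessian_local`, (132) `isPseudoDist_torus`, `torus_sum_exp_le`, (189) `summable_exp_l1`), (185)
`…SupZdPropagatorPeriodic` (through it PTC `exists_windowMap_siteOf`, `siteOf_add_smul`, `natCast_mul_smul_eq`, (55) `blk_translate`),
Mathlib's `tendsto_tsum_of_dominated_convergence`, `tsum_eq_sum`.

WHY (located).  The third next-scale object of the road is the fluctuation covariance `C = H⁻¹ − H⁻¹Q′*(Q′H⁻¹Q′*)⁻¹Q′H⁻¹`; (139) displayed
`Cf` on the torus for block sources, (201) on `ℤ^d`.  Regrouping the torus response part as `Σ_{y″}m_k(y″)R_k(y″)` with the torus responses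
`R_k(y″) = Σ_{y′}T_k⁻¹(y′,y″)ψ^k_{y′}(σ_kp)` and reading `y″ = σb″` through the window turns it into a `ℤ^d` series with window-supported terms;
termwise `m_k(σb″) → m(b″)` ((184) on the `(n+1)^d` points of the block, beyond the window radius of `b″`) and `R_k(σb″) → h_{b″}(p)` ((204));
the domination is `|m_k(y″)| ≤ C_pM_fe^{−δ_pρ_k(y″,σb₀)}` ((155): every fine point of the block of `wm y″` has coarse block `y″`, §1) times
`|R_k| ≤ c₁C₀K_{δ₁}` ((135), (152), (132)), and `ρ_k(σb″,σb₀) ≥ |b″|₁ − |b₀|₁` on the window — summable in `b″`, uniform in `k`: Tannery.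

WHAT IS PROVED ([folklore]): §1 `coarse_block_of_block_point` (`q ∈ B n (wm y″)` ⟹ `σ(blk n (wm(σq))) = y″`); §2 **`torus_fluctuation_tendsto`**
(for ALL `n`, `V` of the class, `Ψ`, cube limit `M`, tower family `ψ^k`, block source `f` at `b₀`, bounded `ℤ^d` solution `u`, torus solutions
`u_k` of the window readings, and `p`: the torus fluctuation part at `σ_kp` → `u(p) − Σ′_{b″}m(b″)Σ′_{b′}M(b′,b″)Ψ_{b′}(p)`); §3 toy.

HONEST (what this is NOT).  Pointwise convergence on block sources (no rate typed; general sources by superposition); the `H + K` column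
and anything non-quadratic are not here; the LINEAR column only; `d ≥ 3` only; scalar skeleton ((A3), NC-NE7b-α UNRULED); nothing of the
covariant propagators of [B4]–[B6]; nothing of Bałaban's asserted.  BY-NAME EFFECT ON THE WALL: NONE.  NE7b NOT PRINTED ∕ NOT PROVED; spine
PROVED 0∕9; rung (B)+1 — the quadratic part of one RG step has a thermodynamic limit, the programme's MEASURES remain FINITE-torus
statements; NOT the mass gap, NOT Clay.  HONEST DEPENDENCY: continuum YM on T⁴ ⇐ BetaPertH ∧ nine spine estimates (0∕9 proved); BetaPertH ⇐
(D1) ∧ (D4) ∧ CAP+tail; G-an2-4 gates asym, D1 and NE2∕3∕4.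
-/

set_option autoImplicit false

noncomputable section

namespace Summit.QuantumFields.BalabanUV.T4Continuum.NE7b.SupZdCovarianceTorusLimit

open Real Filter Topology
open Literature.MathematicalPhysics.QuantumFieldTheory.Balaban1983to89
open B6QGQLower276 (X e blk B side chart mem_B sum_B sum_B_const card_cube blk_chart)
open Beta (Site siteOf windowMap siteOf_windowMap windowMap_siteOf)
open PeriodicSupTorusCarrier (exists_windowMap_siteOf siteOf_add_smul natCast_mul_smul_eq)
open OneShotChartTorusRowsZd (blk_translate)
open SupTorusBlockDistance (isPseudoDist_torus torus_sum_exp_le)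
open SupTorusSupNormRoad (supNorm_bound_road)
open SupTorusPointwiseRoadColumn (propagator_pointwise_decay_road)
open SupTorusCoarseFloor (nextScale_hessian_local)
open SupZdPropagatorLimit (torusNorm_le_l1 inWindow_of_le)
open SupZdPropagatorRegularity (bounded_solution_is_tower_limit)
open SupZdCoarseOperator (sum_window_reading)
open SupZdExponentialSums (summable_exp_l1)
open SupZdCoarseTorusSeam (torusNorm_eq_l1)
open SupZdResponseTorusLimit (torus_response_tendsto)

variable {d : ℕ}

/-! ## §1. The coarse block of every fine point of the block of a window representative -/

/-- For `q` in the block of `wm y″`, the coarse torus block of `σ q` is `y″`: `σ(blk n (wm(σ q))) = y″` (the window representative of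
`σ q` is a period translate of `q`, whose block is a coarse-period translate of `blk n q = wm y″`). [folklore] -/
theorem coarse_block_of_block_point (n k : ℕ) (y'' : Site d (3 ^ k)) (q : X d) (hq : q ∈ B n (windowMap d (3 ^ k) y'')) :
    siteOf d (3 ^ k) (blk n (windowMap d ((n + 1) * 3 ^ k) (siteOf d ((n + 1) * 3 ^ k) q))) = y'' := by
  obtain ⟨m, hm⟩ := exists_windowMap_siteOf ((n + 1) * 3 ^ k) q
  rw [hm, natCast_mul_smul_eq, blk_translate, mem_B.1 hq, siteOf_add_smul, siteOf_windowMap]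

/-! ## §2. THE END: the torus fluctuation parts converge to the infinite-volume fluctuation part -/

/-- **HEADLINE — THE THERMODYNAMIC LIMIT OF THE FLUCTUATION COVARIANCE ON A BLOCK SOURCE**: for `V : ℤ^d → [−λ, Λ]` (`d ≥ 3`, every mesh),
ANY bounded `ℤ^d` block columns `Ψ`, ANY cube limit `M`, ANY tower family `ψ^k` of torus block columns, a source `f` supported in the block
`b₀` with `|f| ≤ M_f`, THE bounded `ℤ^d` solution `u` of `H_Vu = f`, and ANY torus solutions `u_k` of the window readings: at every
`p ∈ ℤ^d` the torus fluctuation part ((139): `u_k(σ_kp) − Σ_{y′}(Σ_{y″}T_k⁻¹(y′,y″)m_k(y″))ψ^k_{y′}(σ_kp)`, `m_k` the block means of `u_k`)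
CONVERGES to the infinite-volume one ((201): `u(p) − Σ′_{b″}m(b″)Σ′_{b′}M(b′,b″)Ψ_{b′}(p)`) — (184) for `u_k → u` and the block means,
(204) for the responses, Tannery over `b″` under the domination `C·M_f·e^{δ|b₀|₁}e^{−δ|b″|₁}` ((155)'s decay of `u_k`, (135)+(152) for the
torus responses). [folklore] -/
theorem torus_fluctuation_tendsto (hd : 3 ≤ d) (a : ℝ) (ha : 0 < a) {lam Lam : ℝ} (hlam : lam < min 2 a) (hLam : 0 ≤ Lam)
    (n : ℕ) (V : X d → ℝ) (hV : ∀ p, -lam ≤ V p) (hV' : ∀ p, V p ≤ Lam)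
    (Ψ : X d → X d → ℝ) (BΨ : X d → ℝ) (hΨB : ∀ b' p, |Ψ b' p| ≤ BΨ b')
    (hΨ : ∀ b' p, ((n : ℝ) + 1) ^ 2 * ∑ μ, (2 * Ψ b' p - Ψ b' (p + e μ) - Ψ b' (p - e μ))
      + a / ((n : ℝ) + 1) ^ d * ∑ q ∈ B n (blk n p), Ψ b' q + V p * Ψ b' p = if blk n p = b' then 1 else 0)
    (M : X d → X d → ℝ) (hM : ∀ b b' : X d, Tendsto (fun R : ℕ =>
        if h : b ∈ (Fintype.piFinset fun _ : Fin d => Finset.Icc (-(R : ℤ)) R) ∧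
            b' ∈ (Fintype.piFinset fun _ : Fin d => Finset.Icc (-(R : ℤ)) R)
          then (Matrix.of fun c c' : ↥(Fintype.piFinset fun _ : Fin d => Finset.Icc (-(R : ℤ)) R) =>
            (((n : ℝ) + 1) ^ d)⁻¹ * ∑ q ∈ B n (c : X d), Ψ (c' : X d) q)⁻¹ ⟨b, h.1⟩ ⟨b', h.2⟩ else 0)
      atTop (𝓝 (M b b')))
    (ψ : (k : ℕ) → Site d (3 ^ k) → Site d ((n + 1) * 3 ^ k) → ℝ)
    (hψ : ∀ (k : ℕ) (y' : Site d (3 ^ k)) (x : Site d ((n + 1) * 3 ^ k)),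
      ((n : ℝ) + 1) ^ 2 * ∑ μ, (2 * ψ k y' x - ψ k y' (x + siteOf d ((n + 1) * 3 ^ k) (e μ)) - ψ k y' (x - siteOf d ((n + 1) * 3 ^ k) (e μ)))
        + a / ((n : ℝ) + 1) ^ d * ∑ q ∈ B n (blk n (windowMap d ((n + 1) * 3 ^ k) x)), ψ k y' (siteOf d ((n + 1) * 3 ^ k) q)
        + V (windowMap d ((n + 1) * 3 ^ k) x) * ψ k y' x
        = if siteOf d (3 ^ k) (blk n (windowMap d ((n + 1) * 3 ^ k) x)) = y' then 1 else 0)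
    (b₀ : X d) (Mf : ℝ) (f : X d → ℝ) (hf0 : ∀ p, blk n p ≠ b₀ → f p = 0) (hfM : ∀ p, |f p| ≤ Mf)
    (u : X d → ℝ) (Bu : ℝ) (huB : ∀ p, |u p| ≤ Bu)
    (hu : ∀ p, ((n : ℝ) + 1) ^ 2 * ∑ μ, (2 * u p - u (p + e μ) - u (p - e μ))
      + a / ((n : ℝ) + 1) ^ d * ∑ q ∈ B n (blk n p), u q + V p * u p = f p)
    (useq : (k : ℕ) → Site d ((n + 1) * 3 ^ k) → ℝ)
    (husol : ∀ (k : ℕ) (x : Site d ((n + 1) * 3 ^ k)),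
      ((n : ℝ) + 1) ^ 2 * ∑ μ, (2 * useq k x - useq k (x + siteOf d ((n + 1) * 3 ^ k) (e μ)) - useq k (x - siteOf d ((n + 1) * 3 ^ k) (e μ)))
        + a / ((n : ℝ) + 1) ^ d * ∑ q ∈ B n (blk n (windowMap d ((n + 1) * 3 ^ k) x)), useq k (siteOf d ((n + 1) * 3 ^ k) q)
        + V (windowMap d ((n + 1) * 3 ^ k) x) * useq k x = f (windowMap d ((n + 1) * 3 ^ k) x))
    (p : X d) :
    Tendsto (fun k : ℕ => useq k (siteOf d ((n + 1) * 3 ^ k) p) - ∑ y' : Site d (3 ^ k), (∑ y'' : Site d (3 ^ k),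
        (Matrix.of fun y y' : Site d (3 ^ k) => (((n : ℝ) + 1) ^ d)⁻¹ * ∑ z : Fin d → Fin (n + 1),
          ψ k y' (siteOf d ((n + 1) * 3 ^ k) (chart n (windowMap d (3 ^ k) y) z)))⁻¹ y' y''
        * ((((n : ℝ) + 1) ^ d)⁻¹ * ∑ z'' : Fin d → Fin (n + 1), useq k (siteOf d ((n + 1) * 3 ^ k) (chart n (windowMap d (3 ^ k) y'') z''))))
        * ψ k y' (siteOf d ((n + 1) * 3 ^ k) p)) atTop
      (𝓝 (u p - ∑' b'' : X d, ((((n : ℝ) + 1) ^ d)⁻¹ * ∑ q ∈ B n b'', u q) * ∑' b' : X d, M b' b'' * Ψ b' p)) := by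
  classical
  have hm0 : 0 < min 2 a - lam := by linarith
  have hMf : 0 ≤ Mf := (abs_nonneg _).trans (hfM 0)
  have hvol : (0 : ℝ) < ((n : ℝ) + 1) ^ d := by positivity
  obtain ⟨C₀, hC₀, H152⟩ := supNorm_bound_road (d := d) hd a ha hlam hLam
  obtain ⟨Cp, δp, hCp, hδp, H155⟩ := propagator_pointwise_decay_road (d := d) hd a ha hlam hLam
  obtain ⟨c₁, δ₁, hc₁, hδ₁, H135⟩ := nextScale_hessian_local (d := d) a ha hm0 hLam
  have hK : 0 < (2 * (1 - exp (-δ₁))⁻¹) ^ d := pow_pos (mul_pos two_pos (inv_pos.2 (sub_pos.2 (exp_lt_one_iff.2 (by linarith))))) d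
  -- abbreviations
  obtain ⟨Tinv, hTinv⟩ : ∃ Tinv : (k : ℕ) → Site d (3 ^ k) → Site d (3 ^ k) → ℝ, ∀ k y y', Tinv k y y' =
      (Matrix.of fun y y' : Site d (3 ^ k) => (((n : ℝ) + 1) ^ d)⁻¹ * ∑ z : Fin d → Fin (n + 1),
        ψ k y' (siteOf d ((n + 1) * 3 ^ k) (chart n (windowMap d (3 ^ k) y) z)))⁻¹ y y' := ⟨_, fun _ _ _ => rfl⟩
  obtain ⟨mk, hmk⟩ : ∃ mk : (k : ℕ) → Site d (3 ^ k) → ℝ, ∀ k y'', mk k y'' = (((n : ℝ) + 1) ^ d)⁻¹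
      * ∑ z'' : Fin d → Fin (n + 1), useq k (siteOf d ((n + 1) * 3 ^ k) (chart n (windowMap d (3 ^ k) y'') z'')) := ⟨_, fun _ _ => rfl⟩
  obtain ⟨Rk, hRk⟩ : ∃ Rk : (k : ℕ) → Site d (3 ^ k) → ℝ, ∀ k y'', Rk k y'' =
      ∑ y' : Site d (3 ^ k), Tinv k y' y'' * ψ k y' (siteOf d ((n + 1) * 3 ^ k) p) := ⟨_, fun _ _ => rfl⟩
  obtain ⟨F, hF⟩ : ∃ F : ℕ → X d → ℝ, ∀ k b'', F k b'' =
      if windowMap d (3 ^ k) (siteOf d (3 ^ k) b'') = b'' then mk k (siteOf d (3 ^ k) b'') * Rk k (siteOf d (3 ^ k) b'') else 0 :=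
    ⟨_, fun _ _ => rfl⟩
  -- the torus response part regrouped: `Σ_{y′}(Σ_{y″}T⁻¹(y′,y″)m(y″))ψ_{y′} = Σ_{y″}m(y″)R(y″)`, and read through the window
  have hgroup : ∀ k : ℕ, ∑ y' : Site d (3 ^ k), (∑ y'' : Site d (3 ^ k), Tinv k y' y'' * mk k y'') * ψ k y' (siteOf d ((n + 1) * 3 ^ k) p)
      = ∑' b'' : X d, F k b'' := by
    intro k
    have e1 : ∑ y' : Site d (3 ^ k), (∑ y'' : Site d (3 ^ k), Tinv k y' y'' * mk k y'') * ψ k y' (siteOf d ((n + 1) * 3 ^ k) p)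
        = ∑ y'' : Site d (3 ^ k), mk k y'' * Rk k y'' := by
      simp only [hRk, Finset.sum_mul, Finset.mul_sum]
      rw [Finset.sum_comm]
      exact Finset.sum_congr rfl fun y'' _ => Finset.sum_congr rfl fun y' _ => by ring
    rw [e1]
    set W : Finset (X d) := (Finset.univ : Finset (Site d (3 ^ k))).image (windowMap d (3 ^ k)) with hW
    have hWrep : ∀ b'' ∈ W, windowMap d (3 ^ k) (siteOf d (3 ^ k) b'') = b'' := fun b'' hb'' => by
      obtain ⟨y, -, hy⟩ := Finset.mem_image.1 hb''; rw [← hy, siteOf_windowMap]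
    have hF0 : ∀ b'', b'' ∉ W → F k b'' = 0 := fun b'' hb'' => by
      rw [hF, if_neg]
      intro h
      exact hb'' (Finset.mem_image.2 ⟨siteOf d (3 ^ k) b'', Finset.mem_univ _, h⟩)
    rw [tsum_eq_sum (s := W) (fun b'' hb'' => hF0 b'' hb''), ← sum_window_reading (3 ^ k) W hWrep (F k) hF0]
    refine Finset.sum_congr rfl fun y'' _ => ?_
    rw [hF, if_pos (by rw [siteOf_windowMap]), siteOf_windowMap]
  -- termwise convergence
  have hulim : ∀ q : X d, Tendsto (fun k => useq k (siteOf d ((n + 1) * 3 ^ k) q)) atTop (𝓝 (u q)) :=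
    bounded_solution_is_tower_limit hd a ha hlam hLam n V hV hV' f hfM u huB hu useq husol
  have hlim : ∀ b'' : X d, Tendsto (fun k => F k b'') atTop
      (𝓝 (((((n : ℝ) + 1) ^ d)⁻¹ * ∑ q ∈ B n b'', u q) * ∑' b' : X d, M b' b'' * Ψ b' p)) := by
    intro b''
    set k₁ : ℕ := 2 * ∑ i, (b'' i).natAbs + 2 with hk₁
    have hwin : ∀ k, k₁ ≤ k → windowMap d (3 ^ k) (siteOf d (3 ^ k) b'') = b'' := fun k hk =>
      windowMap_siteOf d (3 ^ k) fun i => by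
        have h := inWindow_of_le 0 k b'' (by rw [hk₁] at hk; omega) i
        simpa using h
    -- block means
    have h1 : Tendsto (fun k => mk k (siteOf d (3 ^ k) b'')) atTop (𝓝 ((((n : ℝ) + 1) ^ d)⁻¹ * ∑ q ∈ B n b'', u q)) := by
      have h := (tendsto_finsetSum (B n b'') fun q _ => hulim q).const_mul ((((n : ℝ) + 1) ^ d)⁻¹)
      refine h.congr' (Filter.eventually_atTop.2 ⟨k₁, fun k hk => ?_⟩)
      beta_reduce
      rw [hmk, hwin k hk, sum_B b'' (fun q => useq k (siteOf d ((n + 1) * 3 ^ k) q))]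
    -- responses ((204))
    have h2 : Tendsto (fun k => Rk k (siteOf d (3 ^ k) b'')) atTop (𝓝 (∑' b' : X d, M b' b'' * Ψ b' p)) := by
      have h := torus_response_tendsto hd a ha hlam hLam n V hV hV' Ψ BΨ hΨB hΨ M hM ψ hψ b'' p
      refine h.congr fun k => ?_
      rw [hRk]; exact Finset.sum_congr rfl fun y' _ => by rw [hTinv]
    refine (h1.mul h2).congr' (Filter.eventually_atTop.2 ⟨k₁, fun k hk => ?_⟩)
    beta_reduce; rw [hF, if_pos (hwin k hk)]
  -- uniform bounds: block means of `u_k` decay from `σb₀` ((155)), torus responses are bounded ((135)+(152))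
  have hmkB : ∀ k y'', |mk k y''| ≤ Cp * Mf * exp (-(δp * ∑ i, (((y'' i - (siteOf d (3 ^ k) b₀) i).valMinAbs.natAbs : ℕ) : ℝ))) := by
    intro k y''
    rw [hmk, abs_mul, abs_inv, abs_of_pos hvol, inv_mul_le_iff₀ hvol,
      ← sum_B (windowMap d (3 ^ k) y'') (fun q => useq k (siteOf d ((n + 1) * 3 ^ k) q))]
    calc |∑ q ∈ B n (windowMap d (3 ^ k) y''), useq k (siteOf d ((n + 1) * 3 ^ k) q)|
        ≤ ∑ q ∈ B n (windowMap d (3 ^ k) y''), |useq k (siteOf d ((n + 1) * 3 ^ k) q)| := Finset.abs_sum_le_sum_abs _ _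
      _ ≤ ∑ _q ∈ B n (windowMap d (3 ^ k) y''), Cp * Mf
          * exp (-(δp * ∑ i, (((y'' i - (siteOf d (3 ^ k) b₀) i).valMinAbs.natAbs : ℕ) : ℝ))) := Finset.sum_le_sum fun q hq => by
          have h := H155 n (3 ^ k) (fun x => V (windowMap d ((n + 1) * 3 ^ k) x)) (fun x => hV _) (fun x => hV' _) (siteOf d (3 ^ k) b₀)
            Mf (useq k) (fun x => f (windowMap d ((n + 1) * 3 ^ k) x)) (fun x hx => hf0 _ fun hb => hx (by rw [hb])) (fun x => hfM _)
            (husol k) (siteOf d ((n + 1) * 3 ^ k) q)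
          rw [coarse_block_of_block_point n k y'' q hq] at h
          have hE := exp_pos (δp * ∑ i, (((y'' i - (siteOf d (3 ^ k) b₀) i).valMinAbs.natAbs : ℕ) : ℝ))
          rw [exp_neg, ← div_eq_mul_inv, le_div_iff₀ hE, mul_comm]; exact h
      _ = _ := sum_B_const _ _
  have hψB : ∀ k y' x, |ψ k y' x| ≤ C₀ * 1 := fun k y' x =>
    H152 n (3 ^ k) (fun x => V (windowMap d ((n + 1) * 3 ^ k) x)) (fun x => hV _) (fun x => hV' _) 1 (ψ k y')
      (fun x => if siteOf d (3 ^ k) (blk n (windowMap d ((n + 1) * 3 ^ k) x)) = y' then (1 : ℝ) else 0)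
      (fun x => by split_ifs <;> simp) (hψ k y') x
  have hRkB : ∀ k y'', |Rk k y''| ≤ c₁ * (C₀ * 1) * (2 * (1 - exp (-δ₁))⁻¹) ^ d := by
    intro k y''
    rw [hRk]
    calc |∑ y' : Site d (3 ^ k), Tinv k y' y'' * ψ k y' (siteOf d ((n + 1) * 3 ^ k) p)|
        ≤ ∑ y' : Site d (3 ^ k), |Tinv k y' y'' * ψ k y' (siteOf d ((n + 1) * 3 ^ k) p)| := Finset.abs_sum_le_sum_abs _ _
      _ ≤ ∑ y' : Site d (3 ^ k), c₁ * exp (-(δ₁ * ∑ i, (((y'' i - y' i).valMinAbs.natAbs : ℕ) : ℝ))) * (C₀ * 1) :=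
          Finset.sum_le_sum fun y' _ => by
            rw [abs_mul]
            have e1 := H135 n (3 ^ k) (fun x => V (windowMap d ((n + 1) * 3 ^ k) x)) (fun x => hV _) (fun x => hV' _) (ψ k) (hψ k) y' y''
            rw [← hTinv, (isPseudoDist_torus (d := d) (3 ^ k)).symm y' y''] at e1
            exact mul_le_mul e1 (hψB k y' _) (abs_nonneg _) (by positivity)
      _ = c₁ * (C₀ * 1) * ∑ y' : Site d (3 ^ k), exp (-(δ₁ * ∑ i, (((y'' i - y' i).valMinAbs.natAbs : ℕ) : ℝ))) := by
          rw [Finset.mul_sum]; exact Finset.sum_congr rfl fun y' _ => by ring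
      _ ≤ c₁ * (C₀ * 1) * (2 * (1 - exp (-δ₁))⁻¹) ^ d := mul_le_mul_of_nonneg_left (torus_sum_exp_le (3 ^ k) hδ₁ y'') (by positivity)
  -- summable domination, uniform in `k`
  have hdom : ∀ k b'', ‖F k b''‖ ≤ Cp * Mf * exp (δp * ∑ i, (((b₀ i).natAbs : ℕ) : ℝ)) * (c₁ * (C₀ * 1) * (2 * (1 - exp (-δ₁))⁻¹) ^ d)
      * exp (-(δp * ∑ i, ((((0 : X d) i - b'' i).natAbs : ℕ) : ℝ))) := by
    intro k b''
    rw [Real.norm_eq_abs, hF]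
    split_ifs with hwin
    · rw [abs_mul]
      have e1 := hmkB k (siteOf d (3 ^ k) b'')
      have e2 := hRkB k (siteOf d (3 ^ k) b'')
      have htri := (isPseudoDist_torus (d := d) (3 ^ k)).triangle (siteOf d (3 ^ k) b'') (siteOf d (3 ^ k) b₀) 0
      have hN0 : ∀ y : Site d (3 ^ k), ∑ i, (((y i - (0 : Site d (3 ^ k)) i).valMinAbs.natAbs : ℕ) : ℝ)
          = ∑ i, ((((y i).valMinAbs).natAbs : ℕ) : ℝ) := fun y => Finset.sum_congr rfl fun i _ => by simp
      rw [hN0, hN0, torusNorm_eq_l1 k (siteOf d (3 ^ k) b''), hwin] at htri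
      have e3 := torusNorm_le_l1 (d := d) (3 ^ k) b₀
      have hb0 : ∑ i, ((((0 : X d) i - b'' i).natAbs : ℕ) : ℝ) = ∑ i, (((b'' i).natAbs : ℕ) : ℝ) :=
        Finset.sum_congr rfl fun i _ => by simp
      rw [hb0]
      have e4 : Cp * Mf * exp (-(δp * ∑ i, ((((siteOf d (3 ^ k) b'') i - (siteOf d (3 ^ k) b₀) i).valMinAbs.natAbs : ℕ) : ℝ)))
          ≤ Cp * Mf * exp (δp * ∑ i, (((b₀ i).natAbs : ℕ) : ℝ)) * exp (-(δp * ∑ i, (((b'' i).natAbs : ℕ) : ℝ))) := by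
        rw [mul_assoc (Cp * Mf), ← exp_add]
        exact mul_le_mul_of_nonneg_left (exp_le_exp.2 (by nlinarith)) (by positivity)
      calc |mk k (siteOf d (3 ^ k) b'')| * |Rk k (siteOf d (3 ^ k) b'')|
          ≤ (Cp * Mf * exp (δp * ∑ i, (((b₀ i).natAbs : ℕ) : ℝ)) * exp (-(δp * ∑ i, (((b'' i).natAbs : ℕ) : ℝ))))
            * (c₁ * (C₀ * 1) * (2 * (1 - exp (-δ₁))⁻¹) ^ d) := mul_le_mul (e1.trans e4) e2 (abs_nonneg _) (by positivity)
        _ = _ := by ring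
    · rw [abs_zero]; positivity
  have hbsum : Summable fun b'' : X d => Cp * Mf * exp (δp * ∑ i, (((b₀ i).natAbs : ℕ) : ℝ))
      * (c₁ * (C₀ * 1) * (2 * (1 - exp (-δ₁))⁻¹) ^ d) * exp (-(δp * ∑ i, ((((0 : X d) i - b'' i).natAbs : ℕ) : ℝ))) :=
    (summable_exp_l1 hδp 0).mul_left _
  have hT := tendsto_tsum_of_dominated_convergence hbsum hlim (Eventually.of_forall hdom)
  refine ((hulim p).sub hT).congr fun k => ?_
  rw [← hgroup k]
  simp only [hTinv, hmk]

/-! ## §3. Toy -/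

/-- Toy (`d = 2`, `n = 0`, `k = 1`): the single point of the block of `wm 0` on the mesh-`0` lattice has coarse block `0`. -/
example : siteOf 2 (3 ^ 1) (blk 0 (windowMap 2 ((0 + 1) * 3 ^ 1) (siteOf 2 ((0 + 1) * 3 ^ 1) (windowMap 2 (3 ^ 1) 0)))) = 0 :=
  coarse_block_of_block_point (d := 2) 0 1 0 (windowMap 2 (3 ^ 1) 0) (mem_B.2 (by funext μ; simp [blk, B6QGQLower276.side]))

end Summit.QuantumFields.BalabanUV.T4Continuum.NE7b.SupZdCovarianceTorusLimit
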